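import Summits.Ventures.QEC.Thresholds.RotatedSurfaceCodeSAWThresholds
import Literature.InformationTheory.QuantumCodes.RotatedSurfaceCodeRotation
import Literature.InformationTheory.QuantumCodes.CSSEquivalenceDecoders
import HarnessLib

/-!
# Rotated surface codes of ODD distance `RSC(2i+1)`: the SAW-counting threshold `p₀(μ) > .0357` in BOTH sectors and the
# depolarizing threshold `> .0535` — unconditional, tier CERTIFIED (kernel)

Venture QEC, `Summits/Ventures/QEC/Thresholds/` (LADDER-QEC rung Q5, PARTITION row 09; qec-type-09 gen 6, cell item
«09.RSCSAWZ»). `RotatedSurfaceCodeSAWThresholds.lean` (item 144) certifies `p_c ≥ p₀(2.6939) > .0357` for the `H_X` sector of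
every rotated surface code `RSC(L)` (per-`L` bound `P ≤ L·C·r^L/(1-r)`, `RotatedSurfaceCodeCrossingPathsBound.lean`). The
Literature file `RotatedSurfaceCodeRotation.lean` (this item) proves that for ODD `L` the `X ↔ Z` exchange of `RSC(L)` is
`RSC(L)` re-indexed by the quarter turn of the grid (`RotatedSurface.code_swap_eq_reindex`). Along the odd subfamily
`rscOddCode i = RSC(2i+1)` (Surface-17, -49, -97, … — the rotated codes of odd distance) this file therefore obtains the `H_Z`
sector from the `H_X` sector by pull-back of decoders (lit-2's `CSSCode.zFailure_pullback`, `CSSCode.isMinWeight_zPullback`):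

| theorem | statement | tier |
|---|---|---|
| `rsc_zFailureFamily_odd_le`, `rsc_z_odd_belowThreshold_of_sawCountBound`, `rsc_z_odd_isThresholdLowerBound_kernelSymmK16`, `rsc_z_odd_accuracyThreshold_gt_0357`, `rsc_z_odd_decaysExponentially_0357` | item 144's `H_X`-sector bound `P ≤ L·C·r^L/(1-r)` at `L = 2i+1`: threshold `≥ p₀(2.6939) > .0357` and exponential decay below it along the odd subfamily (every minimum-weight decoder family) | CERTIFIED (kernel) |
| `rscQturnPullback`, `rsc_xFailure_eq_zFailure_pullback`, `rscQturnPullback_isMinWeight`, `rsc_xFailureFamily_odd_eq_pullback` | odd `L`: the `H_Z`-sector failure probability of `D'` IS the `H_X`-sector failure probability of its pull-back along the quarter turn, and minimum weight is preserved | CERTIFIED (kernel) |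
| ★ `rsc_x_odd_isThresholdLowerBound_kernelSymmK16`, `rsc_x_odd_accuracyThreshold_gt_0357`, `rsc_x_odd_accuracyThreshold_minWeight_gt_0357`, `rsc_x_odd_mwpm_isThresholdLowerBound_kernelSymmK16`, `rsc_x_odd_decaysExponentially_0357`, `rsc_x_odd_isThresholdLowerBound_of_connectiveConstant_le` | **`p_c(RSC(2i+1), H_Z sector) ≥ p₀(2.6939) > .0357`** for every minimum-weight decoder family (was `.0285`), canonical instance, every boundary-MWPM family, exponential decay below `.0357`; parametric form `μ(ℤ²) ≤ μ' ⇒ p_c ≥ p₀(μ')` | CERTIFIED (kernel), unconditional |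
| `rsc_odd_bothSectors_belowThreshold_0357`, ★ `rsc_odd_depolarizing_isThresholdLowerBound_kernelSymmK16`, `rsc_odd_depolarizing_accuracyThreshold_gt_0535` (+ `minWeight`) | both sectors below `.0357`; **`p_c^depol(RSC(2i+1)) > .0535`** under sector-wise minimum-weight decoding (was `.0427`) | CERTIFIED (kernel), unconditional |

HONEST FRAMING: certified LOWER bounds at the kernel certificate `μ(ℤ²) ≤ 2.6939`; the `H_Z` sector is asserted for ODD `L`
only — for even `L` no isometry of the `L × L` grid exchanges the two colours (`RSC(2) = [[4,1,2]]` has the `X`-check `XXXX`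
but the `Z`-checks `ZZII`, `IIZZ`), and item 143's `.0285` remains the certified value there; DKLP's printed `.0373` estimate
and the numerical `.1031` (Wang–Harrington–Preskill) are CLAIMS, not asserted. No `native_decide`, no named fact.

## References

* [DennisEtAl2002] E. Dennis, A. Kitaev, A. Landahl, J. Preskill, *Topological quantum memory*, J. Math. Phys. 43 (2002)
  4452–4505, arXiv:quant-ph/0110143, §3.1–3.2, §4.1, §5.3 (eqs. (threshold_2d), (p_c_2d); "This change has no effect on
  the estimate of the threshold").
* [TomitaSvore2014] Y. Tomita, K. M. Svore, PRA 90 (2014) 062320, §2.2 (the rotated layout; Surface-17).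
* [LinPryadko2024] H.-K. Lin, L. P. Pryadko, PRA 109 (2024) 022407, §4.2 Thm 6 (permutation-equivalent CSS codes).
* [PonitzTittmann2000] A. Pönitz, P. Tittmann, Electron. J. Combin. 7 (2000) R21, Table 2 (`d = 2, k = 16`: `2.6939`).
* [WangHarringtonPreskill2003] C. Wang, J. Harrington, J. Preskill, Ann. Phys. 303 (2003) 31–58, abstract (`p_{c0} = .1031`).
-/

noncomputable section

namespace Summit.Ventures.QEC.Thresholds

open Filter Topology Finset Matrix
open Literature.InformationTheory.QuantumCodes
open Literature.InformationTheory.QuantumCodes.RotatedSurface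
open Literature.InformationTheory.QuantumCodes.ToricCode (SAWCountBound)
open Literature.Probability.RandomPlanarGeometry

/-! ### The odd subfamily and its `H_X` sector -/

/-- **The rotated surface codes of odd distance** `RSC(2i+1) = [[(2i+1)², 1, 2i+1]]` (`i = 1`: Surface-17).
[cite: TomitaSvore2014, §2.2 (Surface-17, the rotated distance-3 layout)] -/
abbrev rscOddCode (i : ℕ) :
    CSSCode (Fin (2 * i + 1 + 1) × Fin (2 * i + 1 - 1)) (Fin (2 * i + 1 - 1) × Fin (2 * i + 1 + 1))
      (Fin (2 * i + 1) × Fin (2 * i + 1)) :=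
  rscCode (2 * i)

open Classical in
/-- **Per-size bound along the odd subfamily**: for `L = 2i+1 ≥ 3` and `r = 2ν√(p(1-p)) < 1`, the `H_X`-sector failure
probability of every minimum-weight decoder of `RSC(L)` is `≤ L·C·r^L/(1-r)` (failure ⇒ odd column-`0` residual ⇒ a
rough-to-rough self-avoiding path at least half faulty; item 144). [cite: DennisEtAl2002, §5.3 eq. (fail_2d)] -/
theorem rsc_zFailureFamily_odd_le {C ν : ℝ} (hν : 0 < ν) (hC : SAWCountBound C ν)
    (D : ∀ i, Decoder (Fin (2 * i + 1 + 1) × Fin (2 * i + 1 - 1) → ZMod 2) (Fin (2 * i + 1) × Fin (2 * i + 1) → ZMod 2))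
    (hD : ∀ i, (D i).IsMinWeight (rscOddCode i).zSyndrome ((rscOddCode i).kerX : Set _) hammingNorm) {p : ℝ}
    (hp0 : 0 ≤ p) (hp : p ≤ 1 / 2) (hr1 : 2 * ν * Real.sqrt (p * (1 - p)) < 1) {i : ℕ} (hi : 1 ≤ i) :
    zFailureFamily rscOddCode D i p ≤ ((2 * i + 1 : ℕ) : ℝ) * C * (2 * ν * Real.sqrt (p * (1 - p))) ^ (2 * i + 1) /
      (1 - 2 * ν * Real.sqrt (p * (1 - p))) := by
  refine le_trans ?_ (rsc_sum_bernoulliWeight_oddResidual_le (L := 2 * i + 1) (by omega) hν hC (hD i) hp0 hp hr1)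
  refine Finset.sum_le_sum_of_subset_of_nonneg (fun e he => ?_) fun e _ _ => bernoulliWeight_nonneg hp0 (by linarith) _
  rw [Finset.mem_filter] at he ⊢
  exact ⟨Finset.mem_univ _, rsc_oddResidual_of_not_corrects (by omega) (hD i) he.2⟩

/-- **Below threshold for `4ν² p(1-p) < 1`** (given `cₙ ≤ C νⁿ`) along the odd subfamily: every minimum-weight decoder family
of the `H_X` sector of `RSC(2i+1)` (item 144's per-`L` bound at `L = 2i+1 → ∞`). [cite: DennisEtAl2002, §5.3 eq. (threshold_2d)] -/
theorem rsc_z_odd_belowThreshold_of_sawCountBound {C ν : ℝ} (hν : 0 < ν) (hC : SAWCountBound C ν)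
    (D : ∀ i, Decoder (Fin (2 * i + 1 + 1) × Fin (2 * i + 1 - 1) → ZMod 2) (Fin (2 * i + 1) × Fin (2 * i + 1) → ZMod 2))
    (hD : ∀ i, (D i).IsMinWeight (rscOddCode i).zSyndrome ((rscOddCode i).kerX : Set _) hammingNorm) {p : ℝ}
    (hp0 : 0 ≤ p) (hp : p ≤ 1 / 2) (h4 : 4 * ν ^ 2 * (p * (1 - p)) < 1) :
    BelowThreshold (zFailureFamily rscOddCode D) p := by
  set s := Real.sqrt (p * (1 - p)) with hs
  set r := 2 * ν * s with hr
  have hpp : 0 ≤ p * (1 - p) := mul_nonneg hp0 (by linarith)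
  have hr0 : 0 ≤ r := by rw [hr]; positivity
  have hr1 : r < 1 := by
    have hsq : r ^ 2 = 4 * ν ^ 2 * (p * (1 - p)) := by
      rw [hr, mul_pow, mul_pow, hs, Real.sq_sqrt hpp]; ring
    have h : r ^ 2 < 1 := by rw [hsq]; exact h4
    have := (sq_lt_one_iff_abs_lt_one r).1 h
    rwa [abs_of_nonneg hr0] at this
  have h1r : 0 < 1 - r := by linarith
  have hnonneg : ∀ i : ℕ, 0 ≤ zFailureFamily rscOddCode D i p :=
    fun i => Finset.sum_nonneg fun e _ => bernoulliWeight_nonneg hp0 (by linarith) _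
  have hφ : StrictMono fun i : ℕ => 2 * i + 1 := fun a b h => show 2 * a + 1 < 2 * b + 1 by omega
  have hlim : Tendsto (fun i : ℕ => ((2 * i + 1 : ℕ) : ℝ) * C * r ^ (2 * i + 1) / (1 - r)) atTop (𝓝 0) := by
    have h0 := tendsto_pow_const_mul_const_pow_of_abs_lt_one 1 (show |r| < 1 by rwa [abs_of_nonneg hr0])
    have h1 : Tendsto (fun i : ℕ => ((2 * i + 1 : ℕ) : ℝ) ^ 1 * r ^ (2 * i + 1)) atTop (𝓝 0) :=
      h0.comp hφ.tendsto_atTop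
    have h2 := h1.const_mul (C / (1 - r))
    rw [mul_zero] at h2
    refine h2.congr fun i => ?_
    have h1r0 : 1 - r ≠ 0 := h1r.ne'
    field_simp
  refine squeeze_zero' (Filter.Eventually.of_forall hnonneg) ?_ hlim
  rw [Filter.eventually_atTop]
  exact ⟨1, fun i hi => rsc_zFailureFamily_odd_le hν hC D hD hp0 hp hr1 hi⟩

/-- **`μ(ℤ²) ≤ μ' ⇒ p_c ≥ p₀(μ')`** along the odd subfamily, `H_X` sector, every minimum-weight decoder family.
[cite: DennisEtAl2002, §5.3 eqs. (saw_2), (threshold_2d)] -/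
theorem rsc_z_odd_isThresholdLowerBound_of_connectiveConstant_le {μ' : ℝ} (hμ'1 : 1 ≤ μ')
    (hμ : SAW.Zd.connectiveConstant 2 ≤ μ')
    (D : ∀ i, Decoder (Fin (2 * i + 1 + 1) × Fin (2 * i + 1 - 1) → ZMod 2) (Fin (2 * i + 1) × Fin (2 * i + 1) → ZMod 2))
    (hD : ∀ i, (D i).IsMinWeight (rscOddCode i).zSyndrome ((rscOddCode i).kerX : Set _) hammingNorm) :
    IsThresholdLowerBound (zFailureFamily rscOddCode D) (thresholdValue μ') := by
  refine isThresholdLowerBound_thresholdValue_of_forall_gt hμ'1 fun ν hν p hp0 hp h4 => ?_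
  obtain ⟨C, hC⟩ := exists_sawCountBound_of_connectiveConstant_lt (lt_of_le_of_lt hμ hν)
  exact rsc_z_odd_belowThreshold_of_sawCountBound (by linarith) hC D hD hp0 hp h4

/-- **`H_X` sector of `RSC(2i+1)`: threshold `≥ p₀(2.6939)`** for every minimum-weight decoder family — UNCONDITIONAL, tier
CERTIFIED (kernel). [cite: DennisEtAl2002, §5.3 eq. (threshold_2d)] [cite: PonitzTittmann2000, Table 2 (d = 2, k = 16)] -/
theorem rsc_z_odd_isThresholdLowerBound_kernelSymmK16
    (D : ∀ i, Decoder (Fin (2 * i + 1 + 1) × Fin (2 * i + 1 - 1) → ZMod 2) (Fin (2 * i + 1) × Fin (2 * i + 1) → ZMod 2))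
    (hD : ∀ i, (D i).IsMinWeight (rscOddCode i).zSyndrome ((rscOddCode i).kerX : Set _) hammingNorm) :
    IsThresholdLowerBound (zFailureFamily rscOddCode D) (thresholdValue 2.6939) :=
  rsc_z_odd_isThresholdLowerBound_of_connectiveConstant_le (by norm_num) SAW.Zd.connectiveConstant_two_le_26939 D hD

/-- **`p_c(RSC(2i+1), H_X sector) > .0357`**, every minimum-weight decoder family — UNCONDITIONAL, tier CERTIFIED (kernel).
[cite: DennisEtAl2002, §5.3 eq. (p_c_2d)] -/
theorem rsc_z_odd_accuracyThreshold_gt_0357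
    (D : ∀ i, Decoder (Fin (2 * i + 1 + 1) × Fin (2 * i + 1 - 1) → ZMod 2) (Fin (2 * i + 1) × Fin (2 * i + 1) → ZMod 2))
    (hD : ∀ i, (D i).IsMinWeight (rscOddCode i).zSyndrome ((rscOddCode i).kerX : Set _) hammingNorm) :
    (0.0357 : ℝ) < accuracyThreshold (zFailureFamily rscOddCode D) :=
  lt_of_lt_of_le thresholdValue_26939_bounds.1
    (le_accuracyThreshold (rsc_z_odd_isThresholdLowerBound_kernelSymmK16 D hD)
      ((thresholdValue_le_half _).trans (by norm_num)))

/-- **Exponential decay below `p₀(ν)`** along the odd subfamily (given `cₙ ≤ C νⁿ`, `ν ≥ 1`), `H_X` sector, every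
minimum-weight decoder family and every `0 ≤ p < p₀(ν)`: `P_fail(i) ≤ (2i+1)·C·r^{2i+1}/(1-r) ≤ C'·(i+1)·(r²)^i`.
[cite: DennisEtAl2002, §5.3 eq. (fail_2d)] -/
theorem rsc_z_odd_decaysExponentially_of_sawCountBound {C ν : ℝ} (hν : 1 ≤ ν) (hC : SAWCountBound C ν)
    (D : ∀ i, Decoder (Fin (2 * i + 1 + 1) × Fin (2 * i + 1 - 1) → ZMod 2) (Fin (2 * i + 1) × Fin (2 * i + 1) → ZMod 2))
    (hD : ∀ i, (D i).IsMinWeight (rscOddCode i).zSyndrome ((rscOddCode i).kerX : Set _) hammingNorm) {p : ℝ}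
    (hp₀ : 0 ≤ p) (hpp : p < thresholdValue ν) : DecaysExponentially (zFailureFamily rscOddCode D) p := by
  have hp : p ≤ 1 / 2 := hpp.le.trans (thresholdValue_le_half ν)
  have hlt : p * (1 - p) < thresholdValue ν * (1 - thresholdValue ν) :=
    mul_one_sub_lt_mul_one_sub hpp (by linarith [thresholdValue_le_half ν])
  have hν0 : 0 < ν := lt_of_lt_of_le one_pos hν
  have h4 : 4 * ν ^ 2 * (p * (1 - p)) < 1 := by
    calc 4 * ν ^ 2 * (p * (1 - p)) < 4 * ν ^ 2 * (thresholdValue ν * (1 - thresholdValue ν)) := by gcongr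
      _ = 1 := four_mul_sq_mul_thresholdValue hν
  set s := Real.sqrt (p * (1 - p)) with hs
  set r := 2 * ν * s with hr
  have hpp' : 0 ≤ p * (1 - p) := mul_nonneg hp₀ (by linarith)
  have hr0 : 0 ≤ r := by rw [hr]; positivity
  have hr1 : r < 1 := by
    have hsq : r ^ 2 = 4 * ν ^ 2 * (p * (1 - p)) := by rw [hr, mul_pow, mul_pow, hs, Real.sq_sqrt hpp']; ring
    have h' : r ^ 2 < 1 := by rw [hsq]; exact h4
    have := (sq_lt_one_iff_abs_lt_one r).1 h'
    rwa [abs_of_nonneg hr0] at this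
  have h1r : 0 < 1 - r := by linarith
  have hC0 : 0 ≤ C := by
    have h0 := hC 0
    rw [SAW.count_zero, pow_zero, mul_one, Nat.cast_one] at h0; linarith
  have hA0 : 0 ≤ C * r / (1 - r) := by positivity
  refine decaysExponentially_of_eventually_abs_le (A := 2 * (C * r / (1 - r))) (k := 1) (r := r ^ 2) (by positivity)
    (pow_lt_one₀ hr0 hr1 two_ne_zero) ?_
  rw [Filter.eventually_atTop]
  refine ⟨1, fun i hi => ?_⟩
  have hnonneg : 0 ≤ zFailureFamily rscOddCode D i p :=
    Finset.sum_nonneg fun e _ => bernoulliWeight_nonneg hp₀ (by linarith) _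
  rw [abs_of_nonneg hnonneg]
  have hri : 0 ≤ (r ^ 2) ^ i := by positivity
  have hAt := mul_nonneg hA0 hri
  calc zFailureFamily rscOddCode D i p ≤ ((2 * i + 1 : ℕ) : ℝ) * C * r ^ (2 * i + 1) / (1 - r) :=
        rsc_zFailureFamily_odd_le hν0 hC D hD hp₀ hp hr1 hi
    _ = C * r / (1 - r) * (2 * (i : ℝ) + 1) * (r ^ 2) ^ i := by
        have h1r0 : 1 - r ≠ 0 := h1r.ne'
        push_cast
        rw [← pow_mul]
        field_simp
        ring
    _ ≤ 2 * (C * r / (1 - r)) * ((i : ℝ) + 1) ^ 1 * (r ^ 2) ^ i := by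
        rw [pow_one]
        nlinarith

/-- **Exponential decay at every `0 ≤ p ≤ .0357`** along the odd subfamily, `H_X` sector, every minimum-weight decoder
family — UNCONDITIONAL, tier CERTIFIED (kernel) (walk-count constant at `ν = 2.694 > μ(ℤ²)`).
[cite: DennisEtAl2002, §5.3 eq. (fail_2d)] -/
theorem rsc_z_odd_decaysExponentially_0357
    (D : ∀ i, Decoder (Fin (2 * i + 1 + 1) × Fin (2 * i + 1 - 1) → ZMod 2) (Fin (2 * i + 1) × Fin (2 * i + 1) → ZMod 2))
    (hD : ∀ i, (D i).IsMinWeight (rscOddCode i).zSyndrome ((rscOddCode i).kerX : Set _) hammingNorm) {p : ℝ}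
    (hp₀ : 0 ≤ p) (hpp : p ≤ 0.0357) : DecaysExponentially (zFailureFamily rscOddCode D) p := by
  have hlt : SAW.Zd.connectiveConstant 2 < 2.694 := lt_of_le_of_lt SAW.Zd.connectiveConstant_two_le_26939 (by norm_num)
  obtain ⟨C, hC⟩ := exists_sawCountBound_of_connectiveConstant_lt hlt
  have hval : (0.0357 : ℝ) < thresholdValue 2.694 := by
    unfold thresholdValue
    have : Real.sqrt (1 - 1 / (2.694 : ℝ) ^ 2) < 0.9286 := by
      rw [Real.sqrt_lt' (by norm_num)]
      norm_num
    linarith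
  exact rsc_z_odd_decaysExponentially_of_sawCountBound (by norm_num) hC D hD hp₀ (lt_of_le_of_lt hpp hval)

/-! ### The `H_Z` sector of `RSC(L)`, `L` odd, by pull-back along the quarter turn -/

/-- **Pull-back of an `H_Z`-sector decoder of `RSC(L)` to the `H_X` sector** along the quarter turn:
`s ↦ D'(s ∘ qturn) ∘ qturn⁻¹`. [cite: LinPryadko2024, §4.2 Thm 6 (permutation-equivalent codes)] -/
def rscQturnPullback (L : ℕ) (D' : Decoder (Fin (L - 1) × Fin (L + 1) → ZMod 2) (Fin L × Fin L → ZMod 2)) :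
    Decoder (Fin (L + 1) × Fin (L - 1) → ZMod 2) (Fin L × Fin L → ZMod 2) :=
  fun s => D' (s ∘ ⇑(qturn (L - 1) (L + 1))) ∘ ⇑(qturn L L).symm

open Classical in
/-- **For odd `L`, the `H_Z`-sector failure probability of `D'` IS the `H_X`-sector failure probability of its pull-back**
(every `p`): `(RSC(L)).swap` is `RSC(L)` re-indexed by the quarter turn (`RotatedSurface.code_swap_eq_reindex`) and
code-capacity failure sums are preserved by pull-back (`CSSCode.zFailure_pullback`).
[cite: LinPryadko2024, §4.2 Thm 6] [cite: DennisEtAl2002, §3.1 (lattice and dual lattice)] -/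
theorem rsc_xFailure_eq_zFailure_pullback {L : ℕ} (hL : Odd L)
    (D' : Decoder (Fin (L - 1) × Fin (L + 1) → ZMod 2) (Fin L × Fin L → ZMod 2)) (p : ℝ) :
    (∑ e ∈ univ.filter (fun e : Fin L × Fin L → ZMod 2 =>
        ¬ D'.Corrects (RotatedSurface.code L).xSyndrome ((RotatedSurface.code L).rowSpX : Set (Fin L × Fin L → ZMod 2)) e),
        bernoulliWeight p (supp e)) =
      ∑ e ∈ univ.filter (fun e : Fin L × Fin L → ZMod 2 =>
        ¬ (rscQturnPullback L D').Corrects (RotatedSurface.code L).zSyndrome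
          ((RotatedSurface.code L).rowSpZ : Set (Fin L × Fin L → ZMod 2)) e), bernoulliWeight p (supp e) := by
  have h := CSSCode.zFailure_pullback (RotatedSurface.code L) (qturn (L - 1) (L + 1)).symm (qturn (L + 1) (L - 1)).symm
    (qturn L L).symm D' p
  rw [← code_swap_eq_reindex hL] at h
  exact h

/-- **Minimum weight is preserved by the pull-back** (odd `L`): a minimum-weight decoder of the `H_Z` sector of `RSC(L)` pulls
back to a minimum-weight decoder of the `H_X` sector. [cite: LinPryadko2024, §4.2 Thm 6 (weights are permutation invariant)] -/
theorem rscQturnPullback_isMinWeight {L : ℕ} (hL : Odd L)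
    {D' : Decoder (Fin (L - 1) × Fin (L + 1) → ZMod 2) (Fin L × Fin L → ZMod 2)}
    (hD' : D'.IsMinWeight (RotatedSurface.code L).xSyndrome ((RotatedSurface.code L).kerZ : Set _) hammingNorm) :
    (rscQturnPullback L D').IsMinWeight (RotatedSurface.code L).zSyndrome ((RotatedSurface.code L).kerX : Set _)
      hammingNorm := by
  have hD'' : D'.IsMinWeight
      ((RotatedSurface.code L).reindex (qturn (L - 1) (L + 1)).symm (qturn (L + 1) (L - 1)).symm (qturn L L).symm).zSyndrome
      (((RotatedSurface.code L).reindex (qturn (L - 1) (L + 1)).symm (qturn (L + 1) (L - 1)).symm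
        (qturn L L).symm).kerX : Set (Fin L × Fin L → ZMod 2)) hammingNorm := by
    rw [← code_swap_eq_reindex hL]
    exact hD'
  exact (RotatedSurface.code L).isMinWeight_zPullback _ _ _ hD''

/-- **Family form**: along the odd subfamily the census `X`-sector failure family of `D'` is the `Z`-sector family of the
pull-backs. [cite: LinPryadko2024, §4.2 Thm 6] -/
theorem rsc_xFailureFamily_odd_eq_pullback
    (D' : ∀ i, Decoder (Fin (2 * i + 1 - 1) × Fin (2 * i + 1 + 1) → ZMod 2) (Fin (2 * i + 1) × Fin (2 * i + 1) → ZMod 2)) :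
    xFailureFamily rscOddCode D' = zFailureFamily rscOddCode fun i => rscQturnPullback (2 * i + 1) (D' i) := by
  funext i p
  simp only [xFailureFamily, zFailureFamily]
  exact rsc_xFailure_eq_zFailure_pullback (odd_two_mul_add_one i) (D' i) p

/-- **Transfer principle** (odd subfamily): a threshold bound valid for EVERY minimum-weight decoder family of the `H_X`
sector holds for every minimum-weight decoder family of the `H_Z` sector. [cite: LinPryadko2024, §4.2 Thm 6]
[cite: DennisEtAl2002, §3.1] -/
theorem rsc_x_odd_isThresholdLowerBound_of_z {p₀ : ℝ}
    (h : ∀ D : ∀ i, Decoder (Fin (2 * i + 1 + 1) × Fin (2 * i + 1 - 1) → ZMod 2) (Fin (2 * i + 1) × Fin (2 * i + 1) → ZMod 2),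
      (∀ i, (D i).IsMinWeight (rscOddCode i).zSyndrome ((rscOddCode i).kerX : Set _) hammingNorm) →
        IsThresholdLowerBound (zFailureFamily rscOddCode D) p₀)
    (D' : ∀ i, Decoder (Fin (2 * i + 1 - 1) × Fin (2 * i + 1 + 1) → ZMod 2) (Fin (2 * i + 1) × Fin (2 * i + 1) → ZMod 2))
    (hD' : ∀ i, (D' i).IsMinWeight (rscOddCode i).xSyndrome ((rscOddCode i).kerZ : Set _) hammingNorm) :
    IsThresholdLowerBound (xFailureFamily rscOddCode D') p₀ := by
  rw [rsc_xFailureFamily_odd_eq_pullback]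
  exact h _ fun i => rscQturnPullback_isMinWeight (odd_two_mul_add_one i) (hD' i)

/-- **`μ(ℤ²) ≤ μ' ⇒ p_c ≥ p₀(μ')`** for the `H_Z` sector of `RSC(2i+1)`, every minimum-weight decoder family (parametric in the
certificate: a better `μ` bound re-certifies both sectors by one line). [cite: DennisEtAl2002, §5.3 eqs. (saw_2), (threshold_2d)] -/
theorem rsc_x_odd_isThresholdLowerBound_of_connectiveConstant_le {μ' : ℝ} (hμ'1 : 1 ≤ μ')
    (hμ : SAW.Zd.connectiveConstant 2 ≤ μ')
    (D' : ∀ i, Decoder (Fin (2 * i + 1 - 1) × Fin (2 * i + 1 + 1) → ZMod 2) (Fin (2 * i + 1) × Fin (2 * i + 1) → ZMod 2))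
    (hD' : ∀ i, (D' i).IsMinWeight (rscOddCode i).xSyndrome ((rscOddCode i).kerZ : Set _) hammingNorm) :
    IsThresholdLowerBound (xFailureFamily rscOddCode D') (thresholdValue μ') :=
  rsc_x_odd_isThresholdLowerBound_of_z (rsc_z_odd_isThresholdLowerBound_of_connectiveConstant_le hμ'1 hμ) D' hD'

/-- **Exponential decay below `p₀(ν)` for the `H_Z` sector of `RSC(2i+1)`** (given `cₙ ≤ C νⁿ`, `ν ≥ 1`), every minimum-weight
decoder family — the `H_X`-sector decay of the pull-backs, the failure probabilities being EQUAL.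
[cite: DennisEtAl2002, §3.1 and §5.3 eq. (fail_2d)] -/
theorem rsc_x_odd_decaysExponentially_of_sawCountBound {C ν : ℝ} (hν : 1 ≤ ν) (hC : SAWCountBound C ν)
    (D' : ∀ i, Decoder (Fin (2 * i + 1 - 1) × Fin (2 * i + 1 + 1) → ZMod 2) (Fin (2 * i + 1) × Fin (2 * i + 1) → ZMod 2))
    (hD' : ∀ i, (D' i).IsMinWeight (rscOddCode i).xSyndrome ((rscOddCode i).kerZ : Set _) hammingNorm) {p : ℝ}
    (hp₀ : 0 ≤ p) (hpp : p < thresholdValue ν) : DecaysExponentially (xFailureFamily rscOddCode D') p := by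
  rw [rsc_xFailureFamily_odd_eq_pullback]
  exact rsc_z_odd_decaysExponentially_of_sawCountBound hν hC _
    (fun i => rscQturnPullback_isMinWeight (odd_two_mul_add_one i) (hD' i)) hp₀ hpp

/-- **Exponential decay at every `0 ≤ p ≤ .0357` for the `H_Z` sector of `RSC(2i+1)`**, every minimum-weight decoder family —
UNCONDITIONAL, tier CERTIFIED (kernel). [cite: DennisEtAl2002, §5.3 eq. (fail_2d)] -/
theorem rsc_x_odd_decaysExponentially_0357
    (D' : ∀ i, Decoder (Fin (2 * i + 1 - 1) × Fin (2 * i + 1 + 1) → ZMod 2) (Fin (2 * i + 1) × Fin (2 * i + 1) → ZMod 2))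
    (hD' : ∀ i, (D' i).IsMinWeight (rscOddCode i).xSyndrome ((rscOddCode i).kerZ : Set _) hammingNorm) {p : ℝ}
    (hp₀ : 0 ≤ p) (hpp : p ≤ 0.0357) : DecaysExponentially (xFailureFamily rscOddCode D') p := by
  rw [rsc_xFailureFamily_odd_eq_pullback]
  exact rsc_z_odd_decaysExponentially_0357 _ (fun i => rscQturnPullback_isMinWeight (odd_two_mul_add_one i) (hD' i)) hp₀ hpp

/-- ★ **`H_Z` sector of `RSC(2i+1)`: threshold `≥ p₀(2.6939)`** for every minimum-weight decoder family — UNCONDITIONAL, tier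
CERTIFIED (kernel), from `μ(ℤ²) ≤ 2.6939` and the quarter-turn self-equivalence.
[cite: DennisEtAl2002, §3.1 and §5.3 eq. (threshold_2d)] [cite: PonitzTittmann2000, Table 2 (d = 2, k = 16)] -/
theorem rsc_x_odd_isThresholdLowerBound_kernelSymmK16
    (D' : ∀ i, Decoder (Fin (2 * i + 1 - 1) × Fin (2 * i + 1 + 1) → ZMod 2) (Fin (2 * i + 1) × Fin (2 * i + 1) → ZMod 2))
    (hD' : ∀ i, (D' i).IsMinWeight (rscOddCode i).xSyndrome ((rscOddCode i).kerZ : Set _) hammingNorm) :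
    IsThresholdLowerBound (xFailureFamily rscOddCode D') (thresholdValue 2.6939) :=
  rsc_x_odd_isThresholdLowerBound_of_z rsc_z_odd_isThresholdLowerBound_kernelSymmK16 D' hD'

/-- ★ **`p_c(RSC(2i+1), H_Z sector) > .0357`** for every minimum-weight decoder family — UNCONDITIONAL, tier CERTIFIED
(kernel); was `.0285` (item 143). [cite: DennisEtAl2002, §5.3 eq. (p_c_2d)]
[cite: WangHarringtonPreskill2003, abstract (p_c0 = .1031 ± .0001, numerical)] -/
theorem rsc_x_odd_accuracyThreshold_gt_0357
    (D' : ∀ i, Decoder (Fin (2 * i + 1 - 1) × Fin (2 * i + 1 + 1) → ZMod 2) (Fin (2 * i + 1) × Fin (2 * i + 1) → ZMod 2))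
    (hD' : ∀ i, (D' i).IsMinWeight (rscOddCode i).xSyndrome ((rscOddCode i).kerZ : Set _) hammingNorm) :
    (0.0357 : ℝ) < accuracyThreshold (xFailureFamily rscOddCode D') :=
  lt_of_lt_of_le thresholdValue_26939_bounds.1
    (le_accuracyThreshold (rsc_x_odd_isThresholdLowerBound_kernelSymmK16 D' hD')
      ((thresholdValue_le_half _).trans (by norm_num)))

/-- Canonical instance: minimum-weight decoding of the `Z`-syndrome of the odd-distance rotated surface codes has
`p_c > .0357`. [cite: DennisEtAl2002, §5.1 (E_min) and §5.3] -/
theorem rsc_x_odd_accuracyThreshold_minWeight_gt_0357 :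
    (0.0357 : ℝ) < accuracyThreshold
      (xFailureFamily rscOddCode fun i => Decoder.minWeight (rscOddCode i).xSyndrome hammingNorm) :=
  rsc_x_odd_accuracyThreshold_gt_0357 _ fun i => (rscOddCode i).isMinWeight_minWeight_xSyndrome

/-- **Boundary-MWPM attains `p₀(2.6939)` on the `H_Z` sector of `RSC(2i+1)`** (every graphlike-with-boundary presentation of
`H_Z`, link metric, matching decoder) — UNCONDITIONAL, tier CERTIFIED (kernel).
[cite: DennisEtAl2002, §5.1 (E_min by matching) and §5.3 eq. (threshold_2d)] -/
theorem rsc_x_odd_mwpm_isThresholdLowerBound_kernelSymmK16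
    {ι : ∀ i, Fin (2 * i + 1) × Fin (2 * i + 1) → Sym2 (Option (Fin (2 * i + 1 - 1) × Fin (2 * i + 1 + 1)))}
    (hι : ∀ i, IsGraphlikeVia (rscOddCode i).HZ (ι i)) (m : ∀ i, EdgeMetric (ι i))
    {D' : ∀ i, Decoder (Option (Fin (2 * i + 1 - 1) × Fin (2 * i + 1 + 1)) → ZMod 2)
      (Fin (2 * i + 1) × Fin (2 * i + 1) → ZMod 2)}
    (hD : ∀ i, IsMatchingDecoder (m i) (D' i)) :
    IsThresholdLowerBound (xFailureFamily rscOddCode fun i => boundaryDecoder (D' i)) (thresholdValue 2.6939) :=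
  rsc_x_odd_isThresholdLowerBound_kernelSymmK16 _ fun i => isMinWeight_boundaryDecoder (hι i) (hD i)

/-- **`p_c^{MWPM} > .0357` for the `H_Z` sector of `RSC(2i+1)`**, every boundary-MWPM family — UNCONDITIONAL, tier CERTIFIED
(kernel). [cite: DennisEtAl2002, §5.3 eq. (p_c_2d)] -/
theorem rsc_x_odd_mwpm_accuracyThreshold_gt_0357
    {ι : ∀ i, Fin (2 * i + 1) × Fin (2 * i + 1) → Sym2 (Option (Fin (2 * i + 1 - 1) × Fin (2 * i + 1 + 1)))}
    (hι : ∀ i, IsGraphlikeVia (rscOddCode i).HZ (ι i)) (m : ∀ i, EdgeMetric (ι i))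
    {D' : ∀ i, Decoder (Option (Fin (2 * i + 1 - 1) × Fin (2 * i + 1 + 1)) → ZMod 2)
      (Fin (2 * i + 1) × Fin (2 * i + 1) → ZMod 2)}
    (hD : ∀ i, IsMatchingDecoder (m i) (D' i)) :
    (0.0357 : ℝ) < accuracyThreshold (xFailureFamily rscOddCode fun i => boundaryDecoder (D' i)) :=
  rsc_x_odd_accuracyThreshold_gt_0357 _ fun i => isMinWeight_boundaryDecoder (hι i) (hD i)

/-! ### Both sectors; depolarizing noise (odd distance) -/

/-- **Both sectors at once**: for every `0 ≤ p < .0357`, every pair of minimum-weight decoder families (one per sector) of the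
odd-distance rotated surface codes has BOTH logical failure probabilities `→ 0` — UNCONDITIONAL, tier CERTIFIED (kernel).
[cite: DennisEtAl2002, §4.1 (X and Z errors corrected separately) and §5.3] -/
theorem rsc_odd_bothSectors_belowThreshold_0357
    (DZ : ∀ i, Decoder (Fin (2 * i + 1 + 1) × Fin (2 * i + 1 - 1) → ZMod 2) (Fin (2 * i + 1) × Fin (2 * i + 1) → ZMod 2))
    (hDZ : ∀ i, (DZ i).IsMinWeight (rscOddCode i).zSyndrome ((rscOddCode i).kerX : Set _) hammingNorm)
    (DX : ∀ i, Decoder (Fin (2 * i + 1 - 1) × Fin (2 * i + 1 + 1) → ZMod 2) (Fin (2 * i + 1) × Fin (2 * i + 1) → ZMod 2))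
    (hDX : ∀ i, (DX i).IsMinWeight (rscOddCode i).xSyndrome ((rscOddCode i).kerZ : Set _) hammingNorm)
    {p : ℝ} (hp₀ : 0 ≤ p) (hpp : p < 0.0357) :
    BelowThreshold (zFailureFamily rscOddCode DZ) p ∧ BelowThreshold (xFailureFamily rscOddCode DX) p :=
  ⟨(rsc_z_odd_isThresholdLowerBound_kernelSymmK16 DZ hDZ).anti thresholdValue_26939_bounds.1.le p hp₀ hpp,
    (rsc_x_odd_isThresholdLowerBound_kernelSymmK16 DX hDX).anti thresholdValue_26939_bounds.1.le p hp₀ hpp⟩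

/-- ★ **Depolarizing threshold `≥ (3/2)·p₀(2.6939)` for `RSC(2i+1)`**, decoded sector-wise by ANY pair of minimum-weight decoder
families — UNCONDITIONAL, tier CERTIFIED (kernel) (the two sector thresholds + the `3/2` rule
`depolarizing_isThresholdLowerBound`; was `(3/2)·p₀(3)`, item 143).
[cite: DennisEtAl2002, §4.1 (depolarizing channel; X and Z errors corrected separately)] -/
theorem rsc_odd_depolarizing_isThresholdLowerBound_kernelSymmK16
    (DX : ∀ i, Decoder (Fin (2 * i + 1 - 1) × Fin (2 * i + 1 + 1) → ZMod 2) (Fin (2 * i + 1) × Fin (2 * i + 1) → ZMod 2))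
    (DZ : ∀ i, Decoder (Fin (2 * i + 1 + 1) × Fin (2 * i + 1 - 1) → ZMod 2) (Fin (2 * i + 1) × Fin (2 * i + 1) → ZMod 2))
    (hDX : ∀ i, (DX i).IsMinWeight (rscOddCode i).xSyndrome ((rscOddCode i).kerZ : Set _) hammingNorm)
    (hDZ : ∀ i, (DZ i).IsMinWeight (rscOddCode i).zSyndrome ((rscOddCode i).kerX : Set _) hammingNorm) :
    IsThresholdLowerBound (depolarizingFailureFamily rscOddCode DX DZ) (3 / 2 * thresholdValue 2.6939) := by
  have h := depolarizing_isThresholdLowerBound rscOddCode DX DZ (rsc_x_odd_isThresholdLowerBound_kernelSymmK16 DX hDX)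
    (rsc_z_odd_isThresholdLowerBound_kernelSymmK16 DZ hDZ) ((min_le_left _ _).trans (thresholdValue_le_two_thirds _))
  rwa [min_self] at h

/-- ★ **`p_c^depol(RSC(2i+1)) > .0535`** (decimal, kernel; was `.0427`) under sector-wise minimum-weight decoding of depolarizing
noise (`(3/2) · .0357 = .05355`). [cite: DennisEtAl2002, §4.1 and §5.3 eq. (p_c_2d)] -/
theorem rsc_odd_depolarizing_accuracyThreshold_gt_0535
    (DX : ∀ i, Decoder (Fin (2 * i + 1 - 1) × Fin (2 * i + 1 + 1) → ZMod 2) (Fin (2 * i + 1) × Fin (2 * i + 1) → ZMod 2))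
    (DZ : ∀ i, Decoder (Fin (2 * i + 1 + 1) × Fin (2 * i + 1 - 1) → ZMod 2) (Fin (2 * i + 1) × Fin (2 * i + 1) → ZMod 2))
    (hDX : ∀ i, (DX i).IsMinWeight (rscOddCode i).xSyndrome ((rscOddCode i).kerZ : Set _) hammingNorm)
    (hDZ : ∀ i, (DZ i).IsMinWeight (rscOddCode i).zSyndrome ((rscOddCode i).kerX : Set _) hammingNorm) :
    (0.0535 : ℝ) < accuracyThreshold (depolarizingFailureFamily rscOddCode DX DZ) := by
  have h := thresholdValue_26939_bounds.1
  refine lt_of_lt_of_le (by linarith)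
    (le_accuracyThreshold (rsc_odd_depolarizing_isThresholdLowerBound_kernelSymmK16 DX DZ hDX hDZ) ?_)
  have := thresholdValue_le_half (2.6939 : ℝ)
  linarith

/-- Canonical instance: minimum-weight decoding of both syndromes of the odd-distance rotated surface codes has depolarizing
threshold `> .0535`. [cite: DennisEtAl2002, §4.1 and §5.1] -/
theorem rsc_odd_depolarizing_accuracyThreshold_minWeight_gt_0535 :
    (0.0535 : ℝ) < accuracyThreshold
      (depolarizingFailureFamily rscOddCode (fun i => Decoder.minWeight (rscOddCode i).xSyndrome hammingNorm)
        fun i => Decoder.minWeight (rscOddCode i).zSyndrome hammingNorm) :=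
  rsc_odd_depolarizing_accuracyThreshold_gt_0535 _ _ (fun i => (rscOddCode i).isMinWeight_minWeight_xSyndrome)
    fun i => (rscOddCode i).isMinWeight_minWeight_zSyndrome

end Summit.Ventures.QEC.Thresholds
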